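import Summits.BirchSwinnertonDyer.BirchSwinnertonDyer.Theorems.KatoDescentTamePotSupersingularTameCoatesSujathaResidueOfKatoZeta
import Summits.BirchSwinnertonDyer.BirchSwinnertonDyer.Theorems.KatoDescentTamePotSupersingularTameUpperDefectOfSplit
import Summits.BirchSwinnertonDyer.BirchSwinnertonDyer.Theorems.KatoDescentTamePotSupersingularTameUpperNonsurjTowerOfFourNamedFacts
import Summits.BirchSwinnertonDyer.BirchSwinnertonDyer.Theorems.KatoDescentTamePotSupersingularTameUpperReducibleDefectOfCountInputs
import HarnessLib

/-!
# Route `KatoDescentTamePotSupersingular` (rung K8-t′, cell `bsd-potss`): the U₀ node `TameUpperDefectRankZero` (item 19982)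
# BY NAME FROM EXACTLY THE OPEN LEAVES OF THE ROUTE'S OWN KEYING — the U₀ bill v9 (after the (36c) four-named-facts re-key of 19202,
# the Kato-zeta split of 19916 and the count-inputs split of 19203), one kernel term composing the four CLOSED glue items

Seat `bsd-potss-k8t-c4` g15; `--supports stmt-BirchSwinnertonDyer-19982 --as helper`; CONDITIONAL (every hypothesis is a route decl BY
NAME); closes nothing.  HONEST FRAMING: BSD is not proved by any of this; item 19982 is DERIVED and stays OPEN at class level; this file
adds no mathematics — it states in ONE theorem what the item costs today.

`tameUpperDefectRankZero_of_leaves`: 19982 ⟸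
* HELD cite-level aliases (never prover targets): `HeldMatarNekovarThm07` (23034), `HeldGrossProp37Two` (23035), `HeldPoitouTateSelmerDuality`
  (23036), `HeldGrossZagierE0ImageFree` (23037), `PublishedInputsHeegner` (19914), `PublishedInputCasselsIsogenyRedT` (19708),
  `HeldKatoZetaBodyInputs` (24326), `KatoTamagawaExactInputs` (19191), `PublishedInputsFineSelmerCM` (19387), and the count-input aliases of
  the U₀-red node `PublishedInputNewformKatoRedT`, `PublishedInputMemberHullCountInputsT`, `PublishedInputRankEqAnalyticRankRedT`,
  `PublishedInputEntireLFunctionRedT` (`PublishedInputIwasawaH1DataRedT` is PROVED in the route file and discharged here);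
* ONE crux: `TameKatoZetaIndivisible` (24439: μ_p of Kato's zeta class = 0 on the residue rows);
* ONE declared residual: `TameRankOne` (19984: the p-part at rank-one (t′) pairs — used only through the lower half at Heegner twists).
Composition: `tameUpperDefectOfSplit_proof` (glue 19204) ∘ {`tameUpperNonsurjTowerOfFourNamedFacts_proof` (glue 23137) with the bundle
`TameUpperNonsurjRoadInputs` assembled from its six conjuncts, the Conj-A residue conjunct by `tameCoatesSujathaResidueOfKatoZeta_proof`
(glue 24440)} ∘ `tameUpperReducibleDefectOfCountInputs_proof` (glue 19712).  Per row, g13–g15's records replace `TameRankOne` by a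
unit-twist certificate and display the published inputs; the class-wide statement needs the two open items above.

References: [Kato2004Asterisque] §13–14; [MatarNekovar2019] Thm. 0.7; [Gross1991] Prop. 3.7 (2); [GrossZagier1986] III (3.1);
[CoatesSujatha2005] Conj. A.
-/

-- the summit and its single problem are both named `BirchSwinnertonDyer` (registry layout D-0017)
set_option linter.dupNamespace false
set_option autoImplicit false

namespace Summit.BirchSwinnertonDyer.BirchSwinnertonDyer.Theorems

open Summit.BirchSwinnertonDyer.BirchSwinnertonDyer.Theses.KatoDescentTamePotSupersingular

/-- **U₀ bill v9 — `TameUpperDefectRankZero` (19982) from exactly the open leaves of the route's own keying.** Hypotheses are route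
decls BY NAME: thirteen HELD cite-level aliases, the crux `TameKatoZetaIndivisible` (24439) and the residual `TameRankOne` (19984);
`PublishedInputIwasawaH1DataRedT` is discharged by the route's own `_holds`. One composition of the four closed glue theorems
(19204, 23137, 24440, 19712). CONDITIONAL; closes nothing. [cite: Kato2004Asterisque, Thm. 13.4 and 14.5 (3)]
[cite: MatarNekovar2019, Thm. 0.7] [cite: CoatesSujatha2005, Conjecture A] -/
theorem tameUpperDefectRankZero_of_leaves
    (hMN : HeldMatarNekovarThm07) (hG37 : HeldGrossProp37Two) (hPT : HeldPoitouTateSelmerDuality)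
    (hGZ : HeldGrossZagierE0ImageFree) (hH : PublishedInputsHeegner) (hC₄ : PublishedInputCasselsIsogenyRedT)
    (hZB : HeldKatoZetaBodyInputs) (hZI : TameKatoZetaIndivisible) (hR : TameRankOne) (hK : KatoTamagawaExactInputs)
    (hF : PublishedInputsFineSelmerCM) (hN : PublishedInputNewformKatoRedT) (hM : PublishedInputMemberHullCountInputsT)
    (hRk : PublishedInputRankEqAnalyticRankRedT) (hE : PublishedInputEntireLFunctionRedT) :
    TameUpperDefectRankZero :=
  tameUpperDefectOfSplit_proof
    (tameUpperNonsurjTowerOfFourNamedFacts_proof hMN hG37 hPT hGZ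
      ⟨hH, hC₄, tameCoatesSujathaResidueOfKatoZeta_proof hZB hZI, hR, hK, hF⟩)
    (tameUpperReducibleDefectOfCountInputs_proof PublishedInputIwasawaH1DataRedT_holds hN hM hC₄ hRk hE) hK

end Summit.BirchSwinnertonDyer.BirchSwinnertonDyer.Theorems
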